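import Summits.AtomisticToContinuum.Crystallization.Theorems.FreeSplittingCertificatesStrictSplittingRuleP1FarCellCarriers
import Summits.AtomisticToContinuum.Crystallization.Theorems.FreeSplittingCertificatesStrictSplittingRuleP1FarCellTension

/-!
# `StrictSplittingRule` (stmt-AtomisticToContinuum-12560): THE LOAD OF ONE VERTEX PAIR OF A FAR CELL under the exact-rule allocation (P1 interpolant object, part 87)

Route `FreeSplittingCertificates`, crux r3 `StrictSplittingRule` (H12⋆ = `stub_coreJointCoercive`), unit b2b-freesplit-B gen 38.
VALUE = fourth brick of the (B∃) TAIL LEMMA: for a cell `T` all of whose vertices are `≥ 44a` from `y_p`, and any ordered vertex pair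
`(m, m')` with leg `e = (y_m, y_{m'} − y_m)`, the exact-rule share times the readout weight of hypothesis (B∃) (in-layer share `p1FarW` +
the routed vertical shares `p1RouteW`) is at most `J_T · p1LoadCoef`, where `p1LoadCoef (parity, piece, m, m')` is the EXPLICIT asymptotic
coefficient `[d in-layer]·(2/(3a²))/(24·n·|T|) + [d route]·2·(2/3)(1/(4h²))/(24·n·|T|)` (`n` = number of cells around the leg, part 86)
inflated by `Λ* = (507/500)·(10521/10000)⁶` (second-order tension remainder × the lever arm `(5/6 + 99/70)a` of capacity versus tension at
distance `≥ (44 − 5/6)a`).  The cell's own capacity `J_T` has CANCELLED against the share's numerator.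
* `p1RouteW` (the routed vertical weight of a leg, as in (B∃)), `p1LamStar`, `p1LoadNIn`, `p1LoadNV`, `p1LoadCoef`;
* `ratio_bound` (the algebra `(J/(nV·L⁻⁶))·(A·m⁻⁶) ≤ J·(A/(nV))·k⁶` for `L ≤ k·m`), small geometric facts;
* **`pair_load_le`** — `θ_T(e)·(p1FarW e + p1RouteW e) ≤ J_T · p1LoadCoef b π m m'`.
NOT a proof of H12⋆, NOT summit progress.  [folklore]
-/

noncomputable section

open Set Function Metric MeasureTheory Filter Topology
open scoped BigOperators NNReal ENNReal Classical

namespace Summit.AtomisticToContinuum.Crystallization.Theorems.StrictSplittingRuleBirth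

open Literature.MathematicalPhysics.StatisticalMechanics
open Summit.AtomisticToContinuum.Crystallization.Theorems.PalmUnimodularRigidity.LayeredLawsSelectHcp

/-! ## Definitions -/

/-- **The routed vertical weight of a leg** `e` (hypothesis (B∃) of part 83, verbatim): `Σ_i (2/3)([e.2 = route_i(e.1)]·Wv(e.1) +
[route_i(e.1 − (SV − e.2)) = SV − e.2]·Wv(e.1 − (SV − e.2)))`. [folklore] -/
def p1RouteW (a h : ℝ) (φ : Finset ((ℤ × ℤ × ℤ) × (ℤ × ℤ × ℤ))) (p : ℤ × ℤ × ℤ) (e : (ℤ × ℤ × ℤ) × (ℤ × ℤ × ℤ)) : ℝ :=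
  ∑ i : Fin 3, (2 / 3) * ((if e.2 = p1RouteOff e.1 i then p1FarWv a h φ p e.1 else 0) +
    (if p1RouteOff (e.1 - (p1SV - e.2)) i = p1SV - e.2 then p1FarWv a h φ p (e.1 - (p1SV - e.2)) else 0))

/-- The inflation factor `Λ* = (507/500)·(10521/10000)⁶` (tension remainder × capacity lever arm at `≥ (44 − 5/6)a`). [folklore] -/
def p1LamStar : ℝ := 507 / 500 * (10521 / 10000) ^ 6

/-- Number of cells around the leg of the vertex pair `(m, m')` if it is an IN-LAYER stencil leg, else `0`. [folklore] -/
def p1LoadNIn (b : Bool) (π : Fin 6) (m m' : Fin 4) : ℕ :=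
  if p1VertOff b π m' - p1VertOff b π m ∈ p1StencilIn then
    (p1Carriers (parOf b (p1VertOff b π m)) (p1VertOff b π m' - p1VertOff b π m)).card else 0

/-- Number of cells around the leg of the vertex pair `(m, m')` if it is a ROUTE leg of its tail's parity, else `0`. [folklore] -/
def p1LoadNV (b : Bool) (π : Fin 6) (m m' : Fin 4) : ℕ :=
  if p1VertOff b π m' - p1VertOff b π m ∈ p1RouteDirs (parOf b (p1VertOff b π m)) then
    (p1Carriers (parOf b (p1VertOff b π m)) (p1VertOff b π m' - p1VertOff b π m)).card else 0

/-- **THE PER-PAIR LOAD COEFFICIENT** of the vertex pair `(m, m')` of a cell of cube parity `b` and piece `π`: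
`Λ*·(n_in⁻¹·(2/(3a²)) + n_v⁻¹·2·(2/3)·(1/(4h²)))/(24·(√3a²h/12))` (`n⁻¹ = 0` for `n = 0`: no load of that kind). [folklore] -/
def p1LoadCoef (a h : ℝ) (b : Bool) (π : Fin 6) (m m' : Fin 4) : ℝ :=
  (((p1LoadNIn b π m m' : ℝ))⁻¹ * (2 / (3 * a ^ 2) / (24 * (√3 * a ^ 2 * h / 12))) +
    ((p1LoadNV b π m m' : ℝ))⁻¹ * (2 * (2 / 3) * (1 / (4 * h ^ 2)) / (24 * (√3 * a ^ 2 * h / 12)))) * p1LamStar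

/-! ## Small facts -/

/-- `Λ* ≥ 0`. -/
theorem p1LamStar_nonneg : 0 ≤ p1LamStar := by unfold p1LamStar; positivity

/-- The per-pair coefficient is nonnegative (for `0 < a`, `0 < h`). -/
theorem p1LoadCoef_nonneg {a h : ℝ} (ha : 0 < a) (hh : 0 < h) (b : Bool) (π : Fin 6) (m m' : Fin 4) : 0 ≤ p1LoadCoef a h b π m m' := by
  unfold p1LoadCoef
  have := p1LamStar_nonneg
  have h3 : 0 < √3 := Real.sqrt_pos.2 (by norm_num)
  positivity

/-- **The ratio algebra**: `(J/(nV·(L²)⁻³))·(A·(m²)⁻³) ≤ J·(A/(nV))·k⁶` whenever `0 < L ≤ k·m`. -/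
theorem ratio_bound {J nV L m A k : ℝ} (hJ : 0 ≤ J) (hA : 0 ≤ A) (hnV : 0 < nV) (hL : 0 < L) (hm : 0 < m) (hLm : L ≤ k * m) :
    J / (nV * ((L ^ 2)⁻¹) ^ 3) * (A * ((m ^ 2)⁻¹) ^ 3) ≤ J * (A / nV * k ^ 6) := by
  have hid : J / (nV * ((L ^ 2)⁻¹) ^ 3) * (A * ((m ^ 2)⁻¹) ^ 3) = J * (A / nV * (L / m) ^ 6) := by
    have hL' : L ≠ 0 := hL.ne'
    have hm' : m ≠ 0 := hm.ne'
    have hnV' : nV ≠ 0 := hnV.ne'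
    field_simp
  rw [hid]
  have hk : L / m ≤ k := by rw [div_le_iff₀ hm]; exact hLm
  have hk0 : 0 ≤ L / m := by positivity
  gcongr

/-- Directions of the in-layer stencil have `d.1 = 0` (frame weight `2/(3a²)`, bond length `a`). -/
theorem p1StencilIn_fst {d : ℤ × ℤ × ℤ} (hd : d ∈ p1StencilIn) : d.1 = 0 := by
  simp only [p1StencilIn, Finset.mem_insert, Finset.mem_singleton] at hd
  rcases hd with rfl | rfl | rfl <;> rfl

/-- `‖y_d‖ = a` for an in-layer stencil direction. -/
theorem norm_stencilIn {a h : ℝ} (ha : 0 < a) {d : ℤ × ℤ × ℤ} (hd : d ∈ p1StencilIn) : ‖hcpSite a h d‖ = a := by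
  have hsq := h1_stencil_norm_sq a h (p1Stencil_eq ▸ p1StencilIn_subset hd)
  rw [if_pos (p1StencilIn_fst hd)] at hsq
  exact (pow_left_inj₀ (norm_nonneg _) ha.le two_ne_zero).1 (by rw [hsq])

/-- `‖y_SV‖ = 2h`. -/
theorem norm_p1SV {a h : ℝ} (hh : 0 < h) : ‖hcpSite a h p1SV‖ = 2 * h := by
  have hsq := h1_stencil_norm_sq a h (p1Stencil_eq ▸ p1SV_mem)
  rw [if_neg (by decide : ¬(p1SV.1 = 0))] at hsq
  exact (pow_left_inj₀ (norm_nonneg _) (by positivity) two_ne_zero).1 (by rw [hsq]; ring)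

/-- `y_{q + SV} − y_q = y_SV` at every site (the vertical Bravais bond). -/
theorem sub_eq_p1SV (a h : ℝ) (q : ℤ × ℤ × ℤ) : hcpSite a h (q + p1SV) - hcpSite a h q = hcpSite a h p1SV := by
  rw [h1_sub_eq]
  split_ifs
  · rfl
  · rw [h1_neg_of_even a h (by decide : Even p1SV.1), neg_neg]

/-- Reverse triangle inequality for the midpoint: `‖v + ½e‖ ≥ ‖v‖ − ½‖e‖`. -/
theorem norm_add_half_ge (v e : EuclideanSpace ℝ (Fin 3)) : ‖v‖ - 1 / 2 * ‖e‖ ≤ ‖v + (1 / 2 : ℝ) • e‖ := by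
  have h1 : ‖v‖ ≤ ‖v + (1 / 2 : ℝ) • e‖ + ‖(1 / 2 : ℝ) • e‖ := by
    have := norm_add_le (v + (1 / 2 : ℝ) • e) (-((1 / 2 : ℝ) • e))
    rwa [add_neg_cancel_right, norm_neg] at this
  rw [norm_smul, Real.norm_eq_abs, abs_of_pos (by norm_num : (0 : ℝ) < 1 / 2)] at h1
  linarith

/-- The star radius on the box: `√(4a²/3 + h²) ≤ (99/70)a` for `h ≤ 0.81657a`. -/
theorem starRad_le {a h : ℝ} (ha : 0 < a) (hh : 0 < h) (hρ : h ≤ 81657 / 100000 * a) : √(4 * a ^ 2 / 3 + h ^ 2) ≤ 99 / 70 * a := by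
  rw [show 99 / 70 * a = √((99 / 70 * a) ^ 2) by rw [Real.sqrt_sq (by positivity)]]
  refine Real.sqrt_le_sqrt ?_
  have : h ^ 2 ≤ (81657 / 100000 * a) ^ 2 := pow_le_pow_left₀ hh.le hρ 2
  nlinarith

/-- The carrier count of an in-layer stencil leg is positive (by `decide`). -/
theorem p1Carriers_card_pos_in : ∀ b : Bool, ∀ d ∈ p1StencilIn, 0 < (p1Carriers b d).card := by decide

/-- The carrier count of a route leg is positive (by `decide`). -/
theorem p1Carriers_card_pos_route : ∀ b : Bool, ∀ d ∈ p1RouteDirs b, 0 < (p1Carriers b d).card := by decide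

/-! ## The weights of a leg: vanishing and bounds -/

/-- No in-layer share on a leg whose direction is not in the in-layer stencil. -/
theorem p1FarW_eq_zero_of {a h : ℝ} (φ : Finset ((ℤ × ℤ × ℤ) × (ℤ × ℤ × ℤ))) (p x : ℤ × ℤ × ℤ) {d : ℤ × ℤ × ℤ}
    (hd : d ∉ p1StencilIn) : p1FarW a h φ p (x, d) = 0 := by
  unfold p1FarW
  rw [if_neg]
  rintro ⟨_, h2, _⟩
  exact hd h2

/-- No routed share on a leg whose direction is not a route direction of its tail's parity. -/
theorem p1RouteW_eq_zero_of {a h : ℝ} (φ : Finset ((ℤ × ℤ × ℤ) × (ℤ × ℤ × ℤ))) (p x : ℤ × ℤ × ℤ) {d : ℤ × ℤ × ℤ}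
    (hd : d ∉ p1RouteDirs (p1Par x)) : p1RouteW a h φ p (x, d) = 0 := by
  unfold p1RouteW
  refine Finset.sum_eq_zero fun i _ => ?_
  rw [if_neg, if_neg, add_zero, mul_zero]
  · intro hback
    exact hd (mem_dirs_of_routeOff_back hback)
  · intro heq
    have := p1RouteOff_mem_dirs x i
    rw [← heq] at this
    exact hd this

/-- The routed share of a leg against bounds of the two vertical shares it can carry (at most one route index fires for each). -/
theorem p1RouteW_le {a h : ℝ} (φ : Finset ((ℤ × ℤ × ℤ) × (ℤ × ℤ × ℤ))) (p x d : ℤ × ℤ × ℤ) {B₁ B₂ : ℝ} (hB₁ : 0 ≤ B₁) (hB₂ : 0 ≤ B₂)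
    (hW₁ : p1FarWv a h φ p x ≤ B₁) (hW₂ : p1FarWv a h φ p (x - (p1SV - d)) ≤ B₂) :
    p1RouteW a h φ p (x, d) ≤ 2 / 3 * B₁ + 2 / 3 * B₂ := by
  have h1 : ∑ i : Fin 3, (if d = p1RouteOff x i then p1FarWv a h φ p x else 0) ≤ B₁ := by
    calc ∑ i : Fin 3, (if d = p1RouteOff x i then p1FarWv a h φ p x else 0)
        ≤ ∑ i : Fin 3, B₁ * (if d = p1RouteOff x i then (1 : ℝ) else 0) :=
          Finset.sum_le_sum fun i _ => by split_ifs <;> simp [hW₁]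
      _ = B₁ * ∑ i : Fin 3, (if d = p1RouteOff x i then (1 : ℝ) else 0) := by rw [Finset.mul_sum]
      _ ≤ B₁ * 1 := mul_le_mul_of_nonneg_left (sum_ite_eq_routeOff_le_one x d) hB₁
      _ = B₁ := mul_one _
  have h2 : ∑ i : Fin 3, (if p1RouteOff (x - (p1SV - d)) i = p1SV - d then p1FarWv a h φ p (x - (p1SV - d)) else 0) ≤ B₂ := by
    calc ∑ i : Fin 3, (if p1RouteOff (x - (p1SV - d)) i = p1SV - d then p1FarWv a h φ p (x - (p1SV - d)) else 0)
        ≤ ∑ i : Fin 3, B₂ * (if p1RouteOff (x - (p1SV - d)) i = p1SV - d then (1 : ℝ) else 0) :=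
          Finset.sum_le_sum fun i _ => by split_ifs <;> simp [hW₂]
      _ = B₂ * ∑ i : Fin 3, (if p1RouteOff (x - (p1SV - d)) i = p1SV - d then (1 : ℝ) else 0) := by rw [Finset.mul_sum]
      _ ≤ B₂ * 1 := mul_le_mul_of_nonneg_left (sum_ite_routeOff_eq_le_one _ _) hB₂
      _ = B₂ := mul_one _
  have hsplit : p1RouteW a h φ p (x, d) = 2 / 3 * ∑ i : Fin 3, (if d = p1RouteOff x i then p1FarWv a h φ p x else 0) +
      2 / 3 * ∑ i : Fin 3, (if p1RouteOff (x - (p1SV - d)) i = p1SV - d then p1FarWv a h φ p (x - (p1SV - d)) else 0) := by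
    rw [p1RouteW, Finset.mul_sum, Finset.mul_sum, ← Finset.sum_add_distrib]
    refine Finset.sum_congr rfl fun i _ => ?_
    ring
  rw [hsplit]
  linarith

/-! ## The arithmetic of one load (abstract) -/

/-- **One load against the budget (abstract)**: share `θ ≤ J/(nV·(L²)⁻³)` with `L = R + ϱ`, weight `W ≤ A·(m²)⁻³` with `m ≥ R − (5/6)a`,
`R ≥ 44a`, `ϱ ≤ (99/70)a` ⇒ `θ·W ≤ J·(A/(nV))·(10521/10000)⁶`. -/
theorem load_bound {θ J W A n V R ϱ m a : ℝ} (ha : 0 < a) (hθ0 : 0 ≤ θ) (hJ0 : 0 ≤ J) (hA0 : 0 ≤ A) (hn : 0 < n) (hV : 0 < V)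
    (hR : 44 * a ≤ R) (hϱ0 : 0 ≤ ϱ) (hϱ : ϱ ≤ 99 / 70 * a) (hm : R - 5 / 6 * a ≤ m)
    (hθ : θ ≤ J / (n * (V * (((R + ϱ) ^ 2)⁻¹) ^ 3))) (hW : W ≤ A * ((m ^ 2)⁻¹) ^ 3) :
    θ * W ≤ J * (A / (n * V) * (10521 / 10000 : ℝ) ^ 6) := by
  have hm0 : 0 < m := by linarith
  have hL0 : 0 < R + ϱ := by linarith
  have hLm : R + ϱ ≤ 10521 / 10000 * m := by linarith
  have hB0 : 0 ≤ A * ((m ^ 2)⁻¹) ^ 3 := by positivity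
  have hθ' : θ ≤ J / (n * V * (((R + ϱ) ^ 2)⁻¹) ^ 3) := by rw [mul_assoc]; exact hθ
  calc θ * W ≤ θ * (A * ((m ^ 2)⁻¹) ^ 3) := mul_le_mul_of_nonneg_left hW hθ0
    _ ≤ J / (n * V * (((R + ϱ) ^ 2)⁻¹) ^ 3) * (A * ((m ^ 2)⁻¹) ^ 3) := mul_le_mul_of_nonneg_right hθ' hB0
    _ ≤ J * (A / (n * V) * (10521 / 10000 : ℝ) ^ 6) := ratio_bound hJ0 hA0 (mul_pos hn hV) hL0 hm0 hLm

/-- Combining the two routed loads of a leg (abstract): `θR ≤ (4/3)M` from `R ≤ ⅔AX₁ + ⅔AX₂`, `θAX₁ ≤ M`, `θAX₂ ≤ M`, `θ ≥ 0`. -/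
theorem route_combine {θ R A X₁ X₂ M : ℝ} (hθ0 : 0 ≤ θ) (hR : R ≤ 2 / 3 * (A * X₁) + 2 / 3 * (A * X₂))
    (k₁ : θ * (A * X₁) ≤ M) (k₂ : θ * (A * X₂) ≤ M) : θ * R ≤ 4 / 3 * M := by
  have h1 := mul_le_mul_of_nonneg_left hR hθ0
  have e : θ * (2 / 3 * (A * X₁) + 2 / 3 * (A * X₂)) = 2 / 3 * (θ * (A * X₁)) + 2 / 3 * (θ * (A * X₂)) := by ring
  rw [e] at h1
  linarith

/-! ## The load of one vertex pair -/

/-- **THE LOAD OF ONE LEG OF A FAR CELL.**  For the hcp family minimiser `(a,h)`, any base `p`, a cell `T`, a leg `(x, d)` whose ends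
`x`, `x + d` are `≥ 44a` from `y_p`, with `x` of parity `bx`, any shed set `φ`:
`θ_T(x,d)·(p1FarW φ p (x,d) + p1RouteW φ p (x,d)) ≤ J_T·([d ∈ p1StencilIn]·c_in(n) + [d ∈ p1RouteDirs bx]·c_v(n))·Λ*`, `n = (p1Carriers bx d).card`.
NOT a proof of H12⋆, NOT summit progress. [folklore] -/
theorem leg_load_le {a h : ℝ} (ha : 0 < a) (hh : 0 < h) (hfam : HcpFamilyMin a h) (φ : Finset ((ℤ × ℤ × ℤ) × (ℤ × ℤ × ℤ)))
    (p : ℤ × ℤ × ℤ) (T : (ℤ × ℤ × ℤ) × Fin 6) (x d : ℤ × ℤ × ℤ) {bx : Bool} (hbx : p1Par x = bx)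
    (hRx : 44 * a ≤ ‖hcpSite a h x - hcpSite a h p‖) (hRx' : 44 * a ≤ ‖hcpSite a h (x + d) - hcpSite a h p‖) :
    p1ThetaX a h p (x, d) T * (p1FarW a h φ p (x, d) + p1RouteW a h φ p (x, d)) ≤
      p1CellJ a h p T *
        (((Nat.cast (R := ℝ) (if d ∈ p1StencilIn then (p1Carriers bx d).card else 0))⁻¹ * (2 / (3 * a ^ 2) / (24 * (√3 * a ^ 2 * h / 12))) +
          (Nat.cast (R := ℝ) (if d ∈ p1RouteDirs bx then (p1Carriers bx d).card else 0))⁻¹ *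
            (2 * (2 / 3) * (1 / (4 * h ^ 2)) / (24 * (√3 * a ^ 2 * h / 12)))) * p1LamStar) := by
  -- the box
  obtain ⟨hA, hH⟩ := hcpFamilyMin_enclosure ha hh hfam
  rw [abs_sub_le_iff] at hA hH
  obtain ⟨hA1, hA2⟩ := hA
  obtain ⟨hH1, hH2⟩ := hH
  obtain ⟨hρ1, hρ2⟩ := ratioBox_of_hcpFamilyMin ha hh hfam
  have ha' : a ≤ 8 / 5 := by linarith
  have hh' : h ≤ 4 / 5 := by linarith
  have h3 : 0 < √3 := Real.sqrt_pos.2 (by norm_num)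
  have hV0 : 0 < √3 * a ^ 2 * h / 12 := by positivity
  have hϱ0 : 0 ≤ √(4 * a ^ 2 / 3 + h ^ 2) := Real.sqrt_nonneg _
  have hϱle : √(4 * a ^ 2 / 3 + h ^ 2) ≤ 99 / 70 * a := starRad_le ha hh hρ2
  have hRx36 : 36 ≤ ‖hcpSite a h x - hcpSite a h p‖ := by linarith
  have hxp : x ≠ p := by
    intro hxp; rw [hxp, sub_self, norm_zero] at hRx; linarith
  have hfarx : 27 / 5 * a + √(4 * a ^ 2 / 3 + h ^ 2) ≤ ‖hcpSite a h x - hcpSite a h p‖ := by linarith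
  have hfarx' : 27 / 5 * a + √(4 * a ^ 2 / 3 + h ^ 2) ≤ ‖hcpSite a h (x + d) - hcpSite a h p‖ := by linarith
  have hJ0 : 0 ≤ p1CellJ a h p T := p1CellJ_nonneg a h p T
  have hθ0 : 0 ≤ p1ThetaX a h p (x, d) T := p1ThetaX_nonneg a h p (x, d) T
  -- capacity bounds centred at `x` and at `x + d`
  have hcapx := cap_ge_carriers ha hh p x d hbx (Or.inl rfl) hfarx
  have hcapx' := cap_ge_carriers ha hh p x d hbx (z := x + d) (Or.inr rfl) hfarx'
  have hX1 : 0 < (((‖hcpSite a h x - hcpSite a h p‖ + √(4 * a ^ 2 / 3 + h ^ 2)) ^ 2)⁻¹) ^ 3 :=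
    pow_pos (inv_pos.2 (pow_pos (by linarith only [hRx, hϱ0, ha]) 2)) 3
  have hX2 : 0 < (((‖hcpSite a h (x + d) - hcpSite a h p‖ + √(4 * a ^ 2 / 3 + h ^ 2)) ^ 2)⁻¹) ^ 3 :=
    pow_pos (inv_pos.2 (pow_pos (by linarith only [hRx', hϱ0, ha]) 2)) 3
  have hJ0 : 0 ≤ p1CellJ a h p T := p1CellJ_nonneg a h p T
  have hθ0 : 0 ≤ p1ThetaX a h p (x, d) T := p1ThetaX_nonneg a h p (x, d) T
  -- the in-layer part
  have part_in : p1ThetaX a h p (x, d) T * p1FarW a h φ p (x, d) ≤ p1CellJ a h p T *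
      ((Nat.cast (R := ℝ) (if d ∈ p1StencilIn then (p1Carriers bx d).card else 0))⁻¹ * (2 / (3 * a ^ 2) / (24 * (√3 * a ^ 2 * h / 12))) *
        p1LamStar) := by
    by_cases hdin : d ∈ p1StencilIn
    · rw [if_pos hdin]
      have hnpos : (0 : ℝ) < ((p1Carriers bx d).card : ℝ) := by exact_mod_cast p1Carriers_card_pos_in bx d hdin
      have hθle := p1ThetaX_le_div T (mul_pos hnpos (mul_pos hV0 hX1)) hcapx
      have hlam : p1TrussLam a h d = 2 / (3 * a ^ 2) := by rw [p1TrussLam_eq, if_pos (p1StencilIn_fst hdin)]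
      have hW := p1FarW_le_mid ha hh ha' hh' φ p x d (p1StencilIn_subset hdin) hxp hRx36
      rw [hlam] at hW
      have hmbge : ‖hcpSite a h x - hcpSite a h p‖ - 5 / 6 * a ≤ ‖(hcpSite a h x - hcpSite a h p) + (1 / 2 : ℝ) • hcpSite a h d‖ := by
        have := norm_add_half_ge (hcpSite a h x - hcpSite a h p) (hcpSite a h d)
        rw [norm_stencilIn ha hdin] at this
        linarith only [this, ha]
      have hA0 : (0 : ℝ) ≤ 2 / (3 * a ^ 2) / 24 * (507 / 500) := by positivity
      have key := load_bound ha hθ0 hJ0 hA0 hnpos hV0 hRx hϱ0 hϱle hmbge hθle hW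
      refine key.trans (le_of_eq ?_)
      generalize p1CellJ a h p T = J
      generalize ((p1Carriers bx d).card : ℝ) = n
      rw [p1LamStar]
      ring
    · rw [if_neg hdin, p1FarW_eq_zero_of φ p x hdin, mul_zero, Nat.cast_zero, inv_zero, zero_mul, zero_mul, mul_zero]
  -- the routed vertical part
  have part_v : p1ThetaX a h p (x, d) T * p1RouteW a h φ p (x, d) ≤ p1CellJ a h p T *
      ((Nat.cast (R := ℝ) (if d ∈ p1RouteDirs bx then (p1Carriers bx d).card else 0))⁻¹ *
        (2 * (2 / 3) * (1 / (4 * h ^ 2)) / (24 * (√3 * a ^ 2 * h / 12))) * p1LamStar) := by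
    by_cases hdv : d ∈ p1RouteDirs bx
    · rw [if_pos hdv]
      have hnpos : (0 : ℝ) < ((p1Carriers bx d).card : ℝ) := by exact_mod_cast p1Carriers_card_pos_route bx d hdv
      have hlam : p1TrussLam a h p1SV = 1 / (4 * h ^ 2) := by rw [p1TrussLam_eq, if_neg (by decide : ¬(p1SV.1 = 0))]
      have hA0 : (0 : ℝ) ≤ 1 / (4 * h ^ 2) / 24 * (507 / 500) := by positivity
      -- bond 1 (based at `x`, capacity centred at `x`)
      have hθ₁ := p1ThetaX_le_div T (mul_pos hnpos (mul_pos hV0 hX1)) hcapx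
      have hW₁ := p1FarWv_le_mid ha hh ha' hh' φ p x hxp hRx36
      rw [hlam] at hW₁
      have hmb₁ : ‖hcpSite a h x - hcpSite a h p‖ - 5 / 6 * a ≤ ‖(hcpSite a h x - hcpSite a h p) + (1 / 2 : ℝ) • hcpSite a h p1SV‖ := by
        have := norm_add_half_ge (hcpSite a h x - hcpSite a h p) (hcpSite a h p1SV)
        rw [norm_p1SV hh] at this
        linarith only [this, hρ2, ha]
      have key₁ := load_bound ha hθ0 hJ0 hA0 hnpos hV0 hRx hϱ0 hϱle hmb₁ hθ₁ (le_refl (1 / (4 * h ^ 2) / 24 * (507 / 500) *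
          ((‖(hcpSite a h x - hcpSite a h p) + (1 / 2 : ℝ) • hcpSite a h p1SV‖ ^ 2)⁻¹) ^ 3))
      -- bond 2 (based at `x − (SV − d)`, head `x + d`, capacity centred at `x + d`)
      have hq'x : x - (p1SV - d) + p1SV = x + d := by abel
      have hvec : hcpSite a h (x + d) - hcpSite a h (x - (p1SV - d)) = hcpSite a h p1SV := by
        rw [← hq'x]; exact sub_eq_p1SV a h _
      have hRqge : ‖hcpSite a h (x + d) - hcpSite a h p‖ - 2 * h ≤ ‖hcpSite a h (x - (p1SV - d)) - hcpSite a h p‖ := by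
        have htri := norm_sub_le_norm_sub_add_norm_sub (hcpSite a h (x + d)) (hcpSite a h (x - (p1SV - d))) (hcpSite a h p)
        rw [hvec, norm_p1SV hh] at htri
        linarith only [htri]
      have hRq36 : 36 ≤ ‖hcpSite a h (x - (p1SV - d)) - hcpSite a h p‖ := by linarith only [hRqge, hRx', hρ2, hA1, hH2]
      have hq'p : x - (p1SV - d) ≠ p := by
        intro hq; rw [hq, sub_self, norm_zero] at hRq36; linarith only [hRq36]
      have hθ₂ := p1ThetaX_le_div T (mul_pos hnpos (mul_pos hV0 hX2)) hcapx'
      have hW₂ := p1FarWv_le_mid ha hh ha' hh' φ p (x - (p1SV - d)) hq'p hRq36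
      rw [hlam] at hW₂
      have hmb₂ : ‖hcpSite a h (x + d) - hcpSite a h p‖ - 5 / 6 * a ≤
          ‖(hcpSite a h (x - (p1SV - d)) - hcpSite a h p) + (1 / 2 : ℝ) • hcpSite a h p1SV‖ := by
        have hid : (hcpSite a h (x - (p1SV - d)) - hcpSite a h p) + (1 / 2 : ℝ) • hcpSite a h p1SV =
            (hcpSite a h (x + d) - hcpSite a h p) + (1 / 2 : ℝ) • (-hcpSite a h p1SV) := by
          rw [← hvec, smul_neg]; module
        have := norm_add_half_ge (hcpSite a h (x + d) - hcpSite a h p) (-hcpSite a h p1SV)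
        rw [norm_neg, norm_p1SV hh, ← hid] at this
        linarith only [this, hρ2, ha]
      have key₂ := load_bound ha hθ0 hJ0 hA0 hnpos hV0 hRx' hϱ0 hϱle hmb₂ hθ₂ (le_refl (1 / (4 * h ^ 2) / 24 * (507 / 500) *
          ((‖(hcpSite a h (x - (p1SV - d)) - hcpSite a h p) + (1 / 2 : ℝ) • hcpSite a h p1SV‖ ^ 2)⁻¹) ^ 3))
      -- the routed weight against the two bounds, then pure arithmetic on opaque atoms
      have hB₁ : (0 : ℝ) ≤ 1 / (4 * h ^ 2) / 24 * (507 / 500) *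
          ((‖(hcpSite a h x - hcpSite a h p) + (1 / 2 : ℝ) • hcpSite a h p1SV‖ ^ 2)⁻¹) ^ 3 :=
        mul_nonneg hA0 (pow_nonneg (inv_nonneg.2 (sq_nonneg _)) 3)
      have hB₂ : (0 : ℝ) ≤ 1 / (4 * h ^ 2) / 24 * (507 / 500) *
          ((‖(hcpSite a h (x - (p1SV - d)) - hcpSite a h p) + (1 / 2 : ℝ) • hcpSite a h p1SV‖ ^ 2)⁻¹) ^ 3 :=
        mul_nonneg hA0 (pow_nonneg (inv_nonneg.2 (sq_nonneg _)) 3)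
      have hRle := p1RouteW_le φ p x d hB₁ hB₂ hW₁ hW₂
      have fin := route_combine hθ0 hRle key₁ key₂
      refine fin.trans (le_of_eq ?_)
      generalize p1CellJ a h p T = J
      generalize ((p1Carriers bx d).card : ℝ) = n
      rw [p1LamStar]
      ring
    · rw [if_neg hdv, p1RouteW_eq_zero_of φ p x (hbx ▸ hdv), mul_zero, Nat.cast_zero, inv_zero, zero_mul, zero_mul, mul_zero]
  rw [mul_add, add_mul, mul_add]
  exact add_le_add part_in part_v

/-- **THE LOAD OF ONE VERTEX PAIR OF A FAR CELL** (the form used by the assembly): for a cell `T` of cube parity `b` whose vertices `m, m'`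
are `≥ 44a` from `y_p`, the leg `e = (y_m, o_{m'} − o_m)` has `θ_T(e)·(p1FarW e + p1RouteW e) ≤ J_T · p1LoadCoef b π m m'`.
NOT a proof of H12⋆, NOT summit progress. [folklore] -/
theorem pair_load_le {a h : ℝ} (ha : 0 < a) (hh : 0 < h) (hfam : HcpFamilyMin a h) (φ : Finset ((ℤ × ℤ × ℤ) × (ℤ × ℤ × ℤ)))
    (p : ℤ × ℤ × ℤ) (T : (ℤ × ℤ × ℤ) × Fin 6) {b : Bool} (hb : p1Par T.1 = b) (m m' : Fin 4)
    (hRm : 44 * a ≤ ‖hcpSite a h (T.1 + p1VertOff b T.2 m) - hcpSite a h p‖)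
    (hRm' : 44 * a ≤ ‖hcpSite a h (T.1 + p1VertOff b T.2 m') - hcpSite a h p‖) :
    p1ThetaX a h p (T.1 + p1VertOff b T.2 m, p1VertOff b T.2 m' - p1VertOff b T.2 m) T *
        (p1FarW a h φ p (T.1 + p1VertOff b T.2 m, p1VertOff b T.2 m' - p1VertOff b T.2 m) +
          p1RouteW a h φ p (T.1 + p1VertOff b T.2 m, p1VertOff b T.2 m' - p1VertOff b T.2 m)) ≤
      p1CellJ a h p T * p1LoadCoef a h b T.2 m m' := by
  have hbx : p1Par (T.1 + p1VertOff b T.2 m) = parOf b (p1VertOff b T.2 m) := by rw [p1Par_add, hb]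
  have hxd : T.1 + p1VertOff b T.2 m + (p1VertOff b T.2 m' - p1VertOff b T.2 m) = T.1 + p1VertOff b T.2 m' := by abel
  have key := leg_load_le ha hh hfam φ p T (T.1 + p1VertOff b T.2 m) (p1VertOff b T.2 m' - p1VertOff b T.2 m) hbx hRm
    (by rw [hxd]; exact hRm')
  rw [p1LoadCoef, p1LoadNIn, p1LoadNV]
  exact key

end Summit.AtomisticToContinuum.Crystallization.Theorems.StrictSplittingRuleBirth

end
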